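import Summits.BirchSwinnertonDyer.BirchSwinnertonDyer.Theses.PrintCf2
import Summits.BirchSwinnertonDyer.Rank1Residual.WAll.TargetCMTwoInertKrizLiStarDoor
import Summits.BirchSwinnertonDyer.Rank1Residual.P2.KrizLiCubeSumThirteenSlices
import HarnessLib

/-!
# Route PrintCf2, crux `InertJZeroOfFacts` (stmt-20671) — helper: the generic Kriz–Li (★)-door ON THE LEAF from the
# bundle of aside 21366, and its Sylvester cube-sum fibre `x³ + y³ = 13`

Cell `bsd-print-cf2` (D-0131 (2) PRINT TIER, leaf CornerF @ `p = 2`), prover p3 g3; lands `--supports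
stmt-BirchSwinnertonDyer-20671` (sub-family theorems of the `j = 0` crux, K7t doctrine). HONEST FRAMING: the crux
(every globally minimal `W` with `r_an = 1`, `j = 0` satisfies `BSD(W,2)`, relative to 𝔅_inert) is OPEN AS A CLASS;
this file proves SUB-FAMILY statements only, all relative to the antecedent 𝔅⁺ of aside 21366
`InertKrizLiStarDoorOfFactsPlus` (= 𝔅_inert VERBATIM ∧ Kriz–Li Thm 4.3 ∧ Creutz–Miller; every conjunct a published
named fact, the extra two itemised as asides 20767 / 20768):
* `starDoorLeaf_of_bundlePlus : 𝔅⁺ → WAllCornerFTwoInertKrizLiStarDoor` (the W-ALL leaf of p3's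
  `WAll/TargetCMTwoInertKrizLiStarDoor.lean`) and `inertKrizLiStarDoorOfFactsPlus_iff_leaf` (the aside IS
  `𝔅⁺ → leaf`: its inline membership and `P2.IsIsogenousToKrizLiTwistOfSmallCMBase` are equivalent under
  conjuncts 1, 2, 4 of 𝔅_inert and Thm 4.3);
* `inertJZero_starDoor_of_bundlePlus`: the same in the binder shape of crux 20671 (`r_an = 1 → j = 0 → member → BSDp`);
* `inertSlices_iff_off4_of_bundlePlusPlus`: granted 𝔅⁺, ARS06, the Shu–Zhai table row 36a1, the Kriz–Li table row
  243a1 and a proof of the SZ144 leaf, the two inert slices of row 12₂ ARE the residual v4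
  `WAllCornerFTwoInertOffShuZhaiOffKrizLiOffShuZhaiOneFortyFourOffStarDoor` (EXACT);
* `cubeSumThirteen_of_bundlePlus_of_starDatum`: 𝔅⁺ ∧ the DISPLAYED certificate `P2.HasKrizLiStarDatum curve4563b1
  (sqrtField (−23))` ⇒ `BSD(W,2)` on the `ℚ`-isogeny classes of the Kriz–Li twists of the Sylvester cube-sum curve
  `x³ + y³ = 13` (`P2.IsIsogenousToKrizLiCubeSumThirteenTwist`; currency LITERAL-by-name(certificate)).
Beyond print: NO. [cite: KrizLi2019, Thm. 5.1 (2), Thm. 4.3, §6 Ex. 6.2, Table 1, Rem. 6.3] [cite: CreutzMiller2012, Thm. 1.1]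
[cite: BurungaleFlach2024, Thm. 1.1 and Cor. 2] [cite: MilneADT2006, Thm. I.7.3]
-/

set_option linter.dupNamespace false
set_option autoImplicit false

open WeierstrassCurve Literature.NumberTheory.EllipticCurves Literature.NumberTheory.EllipticCurves.Rank1Residual
  Literature.NumberTheory.EllipticCurves.KrizLi2019 Summit.BirchSwinnertonDyer.Rank1Residual
  Summit.BirchSwinnertonDyer.BirchSwinnertonDyer.Theses.PrintCf2

namespace Summit.BirchSwinnertonDyer.PrintCf2

/-- **The (★)-door leaf from the bundle 𝔅⁺ of aside 21366** (𝔅_inert ∧ Thm 4.3 ∧ Creutz–Miller): uses conjuncts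
1 (GZK), 2 (modularity), 3 (Cassels), 4 (Burungale–Flach), 5 (Kriz–Li Thm 5.1 (2)) and the two extra facts.
[cite: KrizLi2019, Thm. 5.1 (2) and Thm. 4.3] [cite: CreutzMiller2012, Thm. 1.1] -/
theorem starDoorLeaf_of_bundlePlus
    (h : ((rank_eq_analyticRank_of_analyticRank_le_one ∧ WeierstrassCurve.hasEntireLFunction_rat ∧
        WeierstrassCurve.bsdRHS_eq_of_isIsogenous ∧ bsdTriple_of_hasCM_of_L_one_ne_zero ∧ thm112_bsdTwo_twist ∧
        ShuZhai2021.thm12_ranks_of_twists ∧ ShuZhai2021.thm14_twoPartBSD_of_twists ∧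
        ShuZhai2021.thm410_twoAdicValuations_of_twists) ∧
      thm33_rank_twist ∧ bsdTriple_of_analyticRank_le_one_of_conductor_lt)) :
    WAllCornerFTwoInertKrizLiStarDoor := by
  obtain ⟨⟨hGZK, hmod, hCas, hBF, hKL, -, -, -⟩, h33, hS31⟩ := h
  exact wAllCornerFTwoInertKrizLiStarDoor_of_facts hKL h33 hS31 hBF hmod hGZK hCas

/-- **Aside 21366 IS `𝔅⁺ → WAllCornerFTwoInertKrizLiStarDoor`** (its inline membership package and
`P2.IsIsogenousToKrizLiTwistOfSmallCMBase` are equivalent granted conjuncts 1, 2, 4 of 𝔅_inert and Thm 4.3, all in 𝔅⁺).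
[cite: KrizLi2019, Thm. 5.1 (2) and Thm. 4.3] -/
theorem inertKrizLiStarDoorOfFactsPlus_iff_leaf :
    InertKrizLiStarDoorOfFactsPlus ↔
      (((rank_eq_analyticRank_of_analyticRank_le_one ∧ WeierstrassCurve.hasEntireLFunction_rat ∧
          WeierstrassCurve.bsdRHS_eq_of_isIsogenous ∧ bsdTriple_of_hasCM_of_L_one_ne_zero ∧ thm112_bsdTwo_twist ∧
          ShuZhai2021.thm12_ranks_of_twists ∧ ShuZhai2021.thm14_twoPartBSD_of_twists ∧
          ShuZhai2021.thm410_twoAdicValuations_of_twists) ∧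
        thm33_rank_twist ∧ bsdTriple_of_analyticRank_le_one_of_conductor_lt) → WAllCornerFTwoInertKrizLiStarDoor) := by
  unfold InertKrizLiStarDoorOfFactsPlus
  refine ⟨fun h hB ↦ ?_, fun h hB ↦ ?_⟩
  · have ⟨⟨hGZK, hmod, _, hBF, _, _, _, _⟩, h33, _⟩ := hB
    exact (wAllCornerFTwoInertKrizLiStarDoor_iff_item_of_facts hGZK h33 hBF hmod).2 (h hB)
  · have ⟨⟨hGZK, hmod, _, hBF, _, _, _, _⟩, h33, _⟩ := hB
    exact (wAllCornerFTwoInertKrizLiStarDoor_iff_item_of_facts hGZK h33 hBF hmod).1 (h hB)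

/-- **The (★)-door in the binder shape of crux 20671** (`r_an = 1 → j = 0 → member → BSDp`; `j = 0` unused), from 𝔅⁺.
[cite: KrizLi2019, Thm. 5.1 (2) and Thm. 4.3] -/
theorem inertJZero_starDoor_of_bundlePlus
    (h : ((rank_eq_analyticRank_of_analyticRank_le_one ∧ WeierstrassCurve.hasEntireLFunction_rat ∧
        WeierstrassCurve.bsdRHS_eq_of_isIsogenous ∧ bsdTriple_of_hasCM_of_L_one_ne_zero ∧ thm112_bsdTwo_twist ∧
        ShuZhai2021.thm12_ranks_of_twists ∧ ShuZhai2021.thm14_twoPartBSD_of_twists ∧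
        ShuZhai2021.thm410_twoAdicValuations_of_twists) ∧
      thm33_rank_twist ∧ bsdTriple_of_analyticRank_le_one_of_conductor_lt)) :
    ∀ (W : WeierstrassCurve ℚ) [W.IsElliptic] [W.IsGloballyMinimal], W.analyticRank = 1 → W.j = 0 →
      P2.IsIsogenousToKrizLiTwistOfSmallCMBase W → BSDp W 2 := by
  obtain ⟨⟨hGZK, hmod, hCas, hBF, hKL, -, -, -⟩, h33, hS31⟩ := h
  exact P2.jZero_krizLiSmallCMBase_byName hKL h33 hS31 hBF hmod hGZK hCas

/-- **After all printed and certified doors, the inert slices ARE the residual v4**: granted 𝔅⁺, ARS06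
(`hARS`), the Shu–Zhai table row 36a1 (`htab36`), the Kriz–Li table row 243a1 (`htab243`) — the antecedents of
asides 20597 / 20766 / 21366 — and a proof `h144` of the SZ144 leaf (aside 21260, p4 g2), the inert slices of row
12₂ hold iff `WAllCornerFTwoInertOffShuZhaiOffKrizLiOffShuZhaiOneFortyFourOffStarDoor` does (EXACT cut; p3's
`wAllCornerFTwoInert_iff_off4_of_facts`). [cite: KrizLi2019, Thm. 5.1 (2)] [cite: ShuZhai2021, Thm. 1.2 and Thm. 1.4] -/
theorem inertSlices_iff_off4_of_bundlePlusPlus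
    (h : ((rank_eq_analyticRank_of_analyticRank_le_one ∧ WeierstrassCurve.hasEntireLFunction_rat ∧
        WeierstrassCurve.bsdRHS_eq_of_isIsogenous ∧ bsdTriple_of_hasCM_of_L_one_ne_zero ∧ thm112_bsdTwo_twist ∧
        ShuZhai2021.thm12_ranks_of_twists ∧ ShuZhai2021.thm14_twoPartBSD_of_twists ∧
        ShuZhai2021.thm410_twoAdicValuations_of_twists) ∧
      thm33_rank_twist ∧ bsdTriple_of_analyticRank_le_one_of_conductor_lt))
    (hARS : AgasheRibetStein2006.cremona_abs_maninConstant_eq_one_of_level_le) (htab36 : ShuZhai2021.table52_row36a1)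
    (htab243 : table1_row243a1) (h144 : WAllCornerFTwoInertShuZhaiOneFortyFour) :
    (WAllCornerFTwoInertGood ∧ WAllCornerFTwoInertBad) ↔
      WAllCornerFTwoInertOffShuZhaiOffKrizLiOffShuZhaiOneFortyFourOffStarDoor := by
  obtain ⟨⟨hGZK, hmod, hCas, hBF, hKL, h12, h14, -⟩, h33, hS31⟩ := h
  exact wAllCornerFTwoInert_iff_off4_of_facts hCas h12 h14 hBF hmod hARS htab36 hKL h33 htab243 hS31 hGZK h144

/-- **The Sylvester cube-sum fibre `x³ + y³ = 13` from 𝔅⁺ and the DISPLAYED certificate** `hSD :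
P2.HasKrizLiStarDatum curve4563b1 (sqrtField (−23))` (lit g5 kit j286962: `P_K = (−14/9, −181/27)`, Heegner index
`1`, `v₂(3·log_ω P_K) = 1`; NOT in print): `BSD(W, 2)` for every globally minimal CM `W` of analytic rank one, `2`
inert, `ℚ`-isogenous to `4563b1^{(d)} ~ C₁₃^{(d)}` or `4563b1^{(−23d)} ~ C₁₃^{(−23d)}`, `d ∈ 𝒩(4563b1, ℚ(√−23))`,
`χ_d(−N) = 1`. Currency LITERAL-by-name(certificate). [cite: KrizLi2019, Thm. 5.1 (2), Thm. 4.3 and §6 Ex. 6.2]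
[cite: HuShuYin2019, p. 2 (ℓ = 2 open for the cube-sum family)] -/
theorem cubeSumThirteen_of_bundlePlus_of_starDatum
    (h : ((rank_eq_analyticRank_of_analyticRank_le_one ∧ WeierstrassCurve.hasEntireLFunction_rat ∧
        WeierstrassCurve.bsdRHS_eq_of_isIsogenous ∧ bsdTriple_of_hasCM_of_L_one_ne_zero ∧ thm112_bsdTwo_twist ∧
        ShuZhai2021.thm12_ranks_of_twists ∧ ShuZhai2021.thm14_twoPartBSD_of_twists ∧
        ShuZhai2021.thm410_twoAdicValuations_of_twists) ∧
      thm33_rank_twist ∧ bsdTriple_of_analyticRank_le_one_of_conductor_lt))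
    (hSD : P2.HasKrizLiStarDatum P2.curve4563b1 (sqrtField (-23))) :
    ∀ (W : WeierstrassCurve ℚ) [W.IsElliptic] [W.IsGloballyMinimal], W.HasCM → W.analyticRank = 1 →
      CMInert W 2 → P2.IsIsogenousToKrizLiCubeSumThirteenTwist W → BSDp W 2 := by
  obtain ⟨⟨hGZK, hmod, hCas, hBF, hKL, -, -, -⟩, h33, hS31⟩ := h
  exact P2.cornerFTwo_krizLiCubeSumThirteen_byName hKL h33 hS31 hBF hmod hGZK hCas hSD

end Summit.BirchSwinnertonDyer.PrintCf2
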